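import Mathlib
import Literature.AlgebraicGeometry.Ramification.InertiaNormalSylow
import Literature.RingTheory.CompleteLocalRings.TameAutomorphismCotangent
import Summits.ResolutionOfSingularities.ResolutionOfSingularities.Theorems.WildQuotientsWildQuotientResolutionStubBorelCore
import HarnessLib

/-!
# Inertia upstairs of a blow-up in an `I`-stable centre is p-closed (crux `WildQuotients.WildQuotientResolution`, line `Sketch`)

Stub `stub_flagCore` of the skeleton `Sketch` for crux stmt-ResolutionOfSingularities-15640
(route `ResolutionOfSingularities/WildQuotients`): the local algebra of one equivariant blow-up
step of Phase 0 ("Sylow separation"). It generalises `BorelCore.stub_borelCore`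
(`Theorems/WildQuotientsWildQuotientResolutionStubBorelCore.lean`: the case `J = 𝔪`,
`dim 𝔪/𝔪² ≤ 2`) to an `I`-stable ideal `J ≤ 𝔪` with `J ∩ 𝔪² ⊆ 𝔪J` whose image `J̄` in
`V = 𝔪/𝔪²` is spanned by two elements and has codimension `≤ 1`; `J S = ι(t) S` upstairs.

Proof: the image of `I` in `GL(V)` stabilises the full flag `W ⊂ J̄ ⊂ V` (`W̃ := {r ∈ J | e_r ∈ 𝔫}`
where `ι r = e_r · ι t`, as in BorelCore) and acts on the three graded lines by characters; their
common kernel `U` acts unipotently of level three on `V`, so `g ^ (p ^ 2)` acts trivially on `V`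
for `g ∈ U` (`pow_apply_sub_mem_of_flag`, `p ∣ (p² choose 2)`): `U` is a `p`-group
(`BorelCore.exists_pow_eq_one_of_cotangentTrivial`) of index prime to `p`
(`hasNormalSylow_of_character`). The characters `μ` on `W` and `ν` on `V/J̄ = κ v̄₀` are two
instances of `exists_character_of_line` (`χ g := e_{τ g t} mod 𝔫` is BorelCore's). If `t = 0` then `J = 0` and `ker ν` already acts trivially on `V`.
-/

-- single-problem summit: the doubled namespace component `ResolutionOfSingularities` is forced
set_option linter.dupNamespace false

open IsLocalRing Literature.AlgebraicGeometry.Ramification Literature.RingTheory.CompleteLocalRings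
open Summit.ResolutionOfSingularities.ResolutionOfSingularities.Theorems.WildQuotientResolution.BorelCore

namespace Summit.ResolutionOfSingularities.ResolutionOfSingularities.Theorems.WildQuotientResolution.FlagCore

/-- If neither `A` nor `B` has a non-trivial element killed by `n`, neither has `A × B`.
[folklore] -/
theorem prod_eq_one_of_pow_eq_one {A B : Type*} [Monoid A] [Monoid B] {n : ℕ}
    (hA : ∀ a : A, a ^ n = 1 → a = 1) (hB : ∀ b : B, b ^ n = 1 → b = 1) :
    ∀ x : A × B, x ^ n = 1 → x = 1 := fun x hx =>
  Prod.ext (hA x.1 (by rw [← Prod.pow_fst, hx, Prod.fst_one]))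
    (hB x.2 (by rw [← Prod.pow_snd, hx, Prod.snd_one]))

section LocalRing

variable {R : Type*} [CommRing R] [IsLocalRing R]

/-- **Iterates of an automorphism unipotent of level three on the cotangent space**: if
`s₁ := φ r - r`, `s₂ := φ s₁ - s₁` and `φ s₂ - s₂ ∈ 𝔪²`, then
`φⁿ r - r - n • s₁ - (n choose 2) • s₂ ∈ 𝔪²` for all `n` (binomial expansion of `(1 + N)ⁿ` with
`N³ ≡ 0`; generalises `BorelCore.pow_apply_sub_sub_nsmul_mem`, the case `N² ≡ 0`). [folklore] -/
theorem pow_apply_sub_mem_of_flag (φ : R ≃+* R) {r : R}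
    (h3 : φ (φ (φ r - r) - (φ r - r)) - (φ (φ r - r) - (φ r - r)) ∈ maximalIdeal R ^ 2) (n : ℕ) :
    (φ ^ n) r - r - n • (φ r - r) - (n.choose 2) • (φ (φ r - r) - (φ r - r)) ∈
      maximalIdeal R ^ 2 := by
  induction n with
  | zero =>
    rw [pow_zero, RingAut.one_apply, Nat.choose_eq_zero_of_lt (by norm_num), zero_nsmul,
      zero_nsmul, sub_zero, sub_zero, sub_self]; exact zero_mem _
  | succ n ih =>
    have hc : (n + 1).choose 2 = n + n.choose 2 := by
      rw [Nat.choose_succ_succ', Nat.choose_one_right]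
    have key : (φ ^ (n + 1)) r - r - (n + 1) • (φ r - r) -
        ((n + 1).choose 2) • (φ (φ r - r) - (φ r - r)) =
        φ ((φ ^ n) r - r - n • (φ r - r) - (n.choose 2) • (φ (φ r - r) - (φ r - r))) +
          (n.choose 2) • (φ (φ (φ r - r) - (φ r - r)) - (φ (φ r - r) - (φ r - r))) := by
      rw [pow_succ', RingAut.mul_apply, hc]
      simp only [map_sub, map_nsmul, add_nsmul]
      simp only [nsmul_eq_mul]; push_cast; ring
    rw [key]
    exact add_mem (ringAut_apply_mem_maximalIdeal_pow φ 2 ih) (nsmul_mem h3 _)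

variable {I : Type*} [Group I]

/-- **The character of a residue-trivial action on a stable line.** Let `τ` be a residue-trivial
action of `I` on the local ring `(R, 𝔪, κ)`, `K ⊇ 𝔪²` a `τ`-stable ideal and `L ⊆ 𝔪` a
`τ`-stable set which is a line modulo `K` (`v₀ ∈ L`, every `r ∈ L` is `≡ a v₀ (mod K)`). Then
some character `ν : I → κˣ` (the scalar of `g` on `v̄₀`; `ν = 1` if `v₀ ∈ K`) has the property
that every `g` with `ν g = 1` acts trivially on `L` modulo `K`. [folklore] -/
theorem exists_character_of_line (τ : I →* (R ≃+* R))
    (hres : ∀ (g : I) (r : R), τ g r - r ∈ maximalIdeal R)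
    {L : Set R} (hLm : ∀ r ∈ L, r ∈ maximalIdeal R) (hLτ : ∀ (g : I), ∀ r ∈ L, τ g r ∈ L)
    (K : Ideal R) (hKτ : ∀ (g : I), ∀ x ∈ K, τ g x ∈ K) (hK2 : maximalIdeal R ^ 2 ≤ K)
    {v₀ : R} (hv₀ : v₀ ∈ L) (hgen : ∀ r ∈ L, ∃ a : R, r - a * v₀ ∈ K) :
    ∃ ν : I →* (ResidueField R)ˣ, ∀ g, ν g = 1 → ∀ r ∈ L, τ g r - r ∈ K := by
  have hmm : ∀ x ∈ maximalIdeal R, ∀ y ∈ maximalIdeal R, x * y ∈ K :=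
    fun x hx y hy => hK2 (by rw [pow_two]; exact Ideal.mul_mem_mul hx hy)
  have hv₀m : v₀ ∈ maximalIdeal R := hLm v₀ hv₀
  by_cases hvK : v₀ ∈ K
  · -- `L ⊆ K`: take `ν = 1`
    refine ⟨1, fun g _ r hr => ?_⟩
    obtain ⟨a, ha⟩ := hgen r hr
    have hrK : r ∈ K := by simpa using add_mem ha (Ideal.mul_mem_left _ a hvK)
    exact sub_mem (hKτ g r hrK) hrK
  -- `L/K = κ v̄₀ ≠ 0`: `τ g v₀ ≡ n g · v₀ (mod K)` with `n g` of well-defined nonzero residue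
  choose n hn using fun g : I => hgen (τ g v₀) (hLτ g v₀ hv₀)
  have hn_uniq : ∀ (g : I) (a : R), τ g v₀ - a * v₀ ∈ K → residue R a = residue R (n g) := by
    intro g a ha
    rw [← sub_eq_zero, ← map_sub, residue_eq_zero_iff]
    by_contra hnot
    obtain ⟨v, hv⟩ := IsUnit.exists_left_inv (by
      rwa [mem_maximalIdeal, mem_nonunits_iff, not_not] at hnot : IsUnit (a - n g))
    have h1 : v * ((a - n g) * v₀) ∈ K :=
      Ideal.mul_mem_left _ v (by convert sub_mem (hn g) ha using 1; ring)
    rw [← mul_assoc, hv, one_mul] at h1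
    exact hvK h1
  have hn_ne : ∀ g, residue R (n g) ≠ 0 := fun g h0 => by
    rw [residue_eq_zero_iff] at h0
    have h1 : τ g v₀ ∈ K := by simpa using add_mem (hn g) (hmm _ h0 _ hv₀m)
    have h2 := hKτ g⁻¹ _ h1
    rw [← RingAut.mul_apply, ← map_mul, inv_mul_cancel, map_one, RingAut.one_apply] at h2
    exact hvK h2
  have hn_one : residue R (n 1) = 1 := by
    rw [← hn_uniq 1 1 (by rw [map_one, RingAut.one_apply, one_mul, sub_self]; exact zero_mem _),
      map_one]
  have hn_mul : ∀ g h, residue R (n (g * h)) = residue R (n g) * residue R (n h) := by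
    intro g h
    rw [← map_mul]
    refine (hn_uniq (g * h) (n g * n h) ?_).symm
    have key : τ (g * h) v₀ - n g * n h * v₀ =
        τ g (τ h v₀ - n h * v₀) + (τ g (n h) - n h) * τ g v₀ + n h * (τ g v₀ - n g * v₀) := by
      rw [map_mul, RingAut.mul_apply, map_sub, map_mul]; ring
    rw [key]
    exact add_mem (add_mem (hKτ g _ (hn h))
      (hmm _ (hres g (n h)) _ (ringAut_apply_mem_maximalIdeal (τ g) hv₀m)))
      (Ideal.mul_mem_left _ _ (hn g))
  obtain ⟨ν, hνv⟩ : ∃ ν : I →* (ResidueField R)ˣ, ∀ g, (ν g : ResidueField R) = residue R (n g) :=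
    ⟨{ toFun := fun g => Units.mk0 (residue R (n g)) (hn_ne g)
       map_one' := Units.ext (by simp only [Units.val_mk0, hn_one, Units.val_one])
       map_mul' := fun g h => Units.ext (by
         simp only [Units.val_mk0, Units.val_mul, hn_mul]) }, fun g => rfl⟩
  refine ⟨ν, fun g hg r hr => ?_⟩
  have hng : n g - 1 ∈ maximalIdeal R := by
    rw [← residue_eq_zero_iff, map_sub, map_one, ← hνv, hg, Units.val_one, sub_self]
  obtain ⟨a, ha⟩ := hgen r hr
  have key : τ g r - r = (τ g (r - a * v₀) - (r - a * v₀)) + (τ g a - a) * τ g v₀ +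
      a * (τ g v₀ - n g * v₀) + a * ((n g - 1) * v₀) := by
    rw [map_sub, map_mul]; ring
  rw [key]
  exact add_mem (add_mem (add_mem (sub_mem (hKτ g _ ha) ha)
    (hmm _ (hres g a) _ (ringAut_apply_mem_maximalIdeal (τ g) hv₀m)))
    (Ideal.mul_mem_left _ _ (hn g))) (Ideal.mul_mem_left _ _ (hmm _ hng _ hv₀m))

/-- **Assembly.** Let `τ` be a faithful residue-trivial action of the finite group `I` on the
Noetherian local ring `R` of residue characteristic `p`, and `f : I → A` a homomorphism to a group
without elements of order `p` such that `g ^ (p ^ N)` acts trivially on `𝔪/𝔪²` for every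
`g ∈ ker f`. Then `ker f` is a normal `p`-subgroup of index prime to `p`
(`BorelCore.exists_pow_eq_one_of_cotangentTrivial`), so `I` has a normal Sylow `p`-subgroup.
[folklore] -/
theorem hasNormalSylow_of_character (p : ℕ) [Fact p.Prime] [IsNoetherianRing R]
    [CharP (ResidueField R) p] [Finite I] {τ : I →* (R ≃+* R)} (hτ : Function.Injective τ)
    (hres : ∀ (g : I) (r : R), τ g r - r ∈ maximalIdeal R)
    {A : Type*} [Group A] (hA : ∀ a : A, a ^ p = 1 → a = 1) (f : I →* A) (N : ℕ)
    (hf : ∀ g, f g = 1 → ∀ r ∈ maximalIdeal R, τ (g ^ p ^ N) r - r ∈ maximalIdeal R ^ 2) :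
    HasNormalSylow p I := by
  have hU : IsPGroup p f.ker := by
    rintro ⟨g, hg⟩
    obtain ⟨k, hk⟩ :=
      exists_pow_eq_one_of_cotangentTrivial p hτ hres (hf g (MonoidHom.mem_ker.mp hg))
    refine ⟨N + k, Subtype.ext ?_⟩
    rw [Subgroup.coe_pow, Subgroup.coe_one, pow_add, pow_mul]
    exact hk
  refine HasNormalSylow.of_normal_of_not_dvd_index f.ker hU fun hdvd => ?_
  rw [Subgroup.index_eq_card] at hdvd
  obtain ⟨x, hx⟩ := exists_prime_orderOf_dvd_card' (G := I ⧸ f.ker) p hdvd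
  have hyp : QuotientGroup.kerLift f x ^ p = 1 := by
    rw [← map_pow, ← hx, pow_orderOf_eq_one, map_one]
  have hx1 : x = 1 := QuotientGroup.kerLift_injective f (by rw [hA _ hyp, map_one])
  rw [hx1, orderOf_one] at hx
  exact (Fact.out : p.Prime).one_lt.ne hx

end LocalRing

/-- **Inertia upstairs of a blow-up whose centre ideal `J` has `dim J̄ ≤ 2` and `codim_V J̄ ≤ 1`
is p-closed** (stub `stub_flagCore` of line `Sketch`, crux stmt-ResolutionOfSingularities-15640;
the flag argument). Let `(R, 𝔪, κ)` be a Noetherian local ring and `(S, 𝔫, κ₁)` a local domain,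
both residue fields of characteristic `p`; `ι : R → S` an injective local homomorphism; `J ≤ 𝔪`
an ideal with `J ∩ 𝔪² ⊆ 𝔪J`, whose image in `V = 𝔪/𝔪²` is spanned by the classes of two
elements of `J` and has codimension `≤ 1` (`V = J̄ + κ v̄₀`); `J S = ι(t) S` for some `t ∈ J`;
`I` a finite group acting on `R` faithfully by `τ`, preserving `J`, and on `S` by `τ₁`,
compatibly (`ι ∘ τ g = τ₁ g ∘ ι`) and residue-trivially on `S`. Then `I` has a normal Sylow
`p`-subgroup: the kernel of `(χ, μ, ν) : I → κ₁ˣ × κˣ × κˣ` is a normal `p`-subgroup of index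
prime to `p`. The case `J = 𝔪` is `BorelCore.stub_borelCore`; Serre, *Corps locaux* IV §2
Cor. 4 is the discrete valuation ring shape. [folklore] -/
theorem stub_flagCore (p : ℕ) [Fact p.Prime]
    {R S : Type*} [CommRing R] [IsLocalRing R] [IsNoetherianRing R]
    [CommRing S] [IsLocalRing S] [IsDomain S]
    [CharP (ResidueField R) p] [CharP (ResidueField S) p]
    (ι : R →+* S) [IsLocalHom ι] (hι : Function.Injective ι)
    (J : Ideal R) (hJm : J ≤ maximalIdeal R)
    (hJ2 : J ⊓ maximalIdeal R ^ 2 ≤ maximalIdeal R * J)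
    (hJgen : ∃ j₁ ∈ J, ∃ j₂ ∈ J, ∀ j ∈ J, ∃ a b : R, j - (a * j₁ + b * j₂) ∈ maximalIdeal R ^ 2)
    (hVgen : ∃ v₀ ∈ maximalIdeal R, ∀ r ∈ maximalIdeal R, ∃ a : R, ∃ j ∈ J,
      r - (a * v₀ + j) ∈ maximalIdeal R ^ 2)
    (t : R) (ht : t ∈ J) (hgen : Ideal.map ι J = Ideal.span {ι t})
    {I : Type*} [Group I] [Finite I] (τ : I →* (R ≃+* R)) (τ₁ : I →* (S ≃+* S))
    (hτ : Function.Injective τ) (hJτ : ∀ (g : I), ∀ j ∈ J, τ g j ∈ J)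
    (hcomp : ∀ (g : I) (r : R), ι (τ g r) = τ₁ g (ι r))
    (hres : ∀ (g : I) (s : S), τ₁ g s - s ∈ maximalIdeal S) :
    HasNormalSylow p I := by
  classical
  have hp : p.Prime := Fact.out
  -- (0) `τ` is residue-trivial on `R` (`ι (τ g r - r) ∈ 𝔫`, `ι` local); `τ g` preserves `𝔪²`
  have hresR : ∀ (g : I) (r : R), τ g r - r ∈ maximalIdeal R := fun g r => by
    have h : ι (τ g r - r) ∈ maximalIdeal S := by rw [map_sub, hcomp]; exact hres g (ι r)
    rw [mem_maximalIdeal, mem_nonunits_iff] at h ⊢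
    exact fun hu => h (hu.map ι)
  have hmm : ∀ x ∈ maximalIdeal R, ∀ y ∈ maximalIdeal R, x * y ∈ maximalIdeal R ^ 2 :=
    fun x hx y hy => by rw [pow_two]; exact Ideal.mul_mem_mul hx hy
  have hp_mem : (p : R) ∈ maximalIdeal R := by
    rw [← residue_eq_zero_iff, map_natCast, CharP.cast_eq_zero]
  have hm2τ : ∀ (g : I), ∀ x ∈ maximalIdeal R ^ 2, τ g x ∈ maximalIdeal R ^ 2 :=
    fun g x hx => ringAut_apply_mem_maximalIdeal_pow (τ g) 2 hx
  -- (4) the character `ν` of `I` on the line `V/J̄ = κ v̄₀` (modulo the `τ`-stable `J + 𝔪²`)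
  have hJ'τ : ∀ (g : I), ∀ x ∈ J ⊔ maximalIdeal R ^ 2, τ g x ∈ J ⊔ maximalIdeal R ^ 2 := by
    intro g x hx
    obtain ⟨j, hj, m, hm, rfl⟩ := Submodule.mem_sup.mp hx
    rw [map_add]
    exact add_mem (Submodule.mem_sup_left (hJτ g j hj)) (Submodule.mem_sup_right (hm2τ g m hm))
  obtain ⟨v₀, hv₀, hV⟩ := hVgen
  obtain ⟨ν, hν⟩ : ∃ ν : I →* (ResidueField R)ˣ, ∀ g, ν g = 1 →
      ∀ r ∈ (maximalIdeal R : Set R), τ g r - r ∈ J ⊔ maximalIdeal R ^ 2 :=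
    exists_character_of_line τ hresR (fun r hr => hr)
      (fun g r hr => ringAut_apply_mem_maximalIdeal (τ g) hr) (J ⊔ maximalIdeal R ^ 2) hJ'τ
      le_sup_right hv₀ fun r hr => by
        obtain ⟨a, j, hj, h⟩ := hV r hr
        exact ⟨a, by
          convert add_mem (Submodule.mem_sup_left hj) (Submodule.mem_sup_right h) using 1; ring⟩
  -- (1) the degenerate case `t = 0`: `J = 0` and `ker ν` acts trivially on `𝔪/𝔪²`
  by_cases ht0 : t = 0
  · have hJ0 : ∀ j ∈ J, j = 0 := fun j hj => by
      have h : ι j ∈ Ideal.span {ι t} := hgen ▸ Ideal.mem_map_of_mem ι hj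
      obtain ⟨a, ha⟩ := Ideal.mem_span_singleton'.mp h
      rw [ht0, map_zero, mul_zero] at ha
      exact hι (by rw [map_zero]; exact ha.symm)
    refine hasNormalSylow_of_character p hτ hresR
      (fun a h => units_eq_one_of_pow_char_eq_one p h) ν 0 fun g hg r hr => ?_
    obtain ⟨j, hj, m, hm, hjm⟩ := Submodule.mem_sup.mp (hν g hg r hr)
    rw [pow_zero, pow_one, ← hjm, hJ0 j hj, zero_add]
    exact hm
  -- (2) `u := ι t ≠ 0`; `e r` with `ι r = e r * u` for `r ∈ J` (unique since `S` is a domain)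
  set u : S := ι t
  have hu0 : u ≠ 0 := fun h => ht0 (hι (by rw [map_zero]; exact h))
  have hex : ∀ r : R, ∃ a : S, r ∈ J → a * u = ι r := fun r => by
    by_cases hr : r ∈ J
    · obtain ⟨a, ha⟩ := Ideal.mem_span_singleton'.mp
        (show ι r ∈ Ideal.span {u} from hgen ▸ Ideal.mem_map_of_mem ι hr)
      exact ⟨a, fun _ => ha⟩
    · exact ⟨0, fun h => absurd h hr⟩
  choose e he using hex
  have he_uniq : ∀ r ∈ J, ∀ a : S, a * u = ι r → e r = a := fun r hr a ha =>
    mul_right_cancel₀ hu0 ((he r hr).trans ha.symm)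
  have he_t : e t = 1 := he_uniq t ht 1 (one_mul u)
  have he_zero : e 0 = 0 := he_uniq 0 (zero_mem _) 0 (by rw [zero_mul, map_zero])
  have he_add : ∀ r ∈ J, ∀ r' ∈ J, e (r + r') = e r + e r' :=
    fun r hr r' hr' => he_uniq _ (add_mem hr hr') _ (by rw [add_mul, he r hr, he r' hr', map_add])
  have he_sub : ∀ r ∈ J, ∀ r' ∈ J, e (r - r') = e r - e r' :=
    fun r hr r' hr' => he_uniq _ (sub_mem hr hr') _ (by rw [sub_mul, he r hr, he r' hr', map_sub])
  have he_smul : ∀ (a : R), ∀ r ∈ J, e (a * r) = ι a * e r :=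
    fun a r hr => he_uniq _ (Ideal.mul_mem_left _ a hr) _ (by rw [mul_assoc, he r hr, map_mul])
  -- `e` sends `𝔪J`, hence (by `hJ2`) `J ∩ 𝔪²`, into `𝔫`
  have he_mJ : ∀ x ∈ maximalIdeal R * J, x ∈ J ∧ e x ∈ maximalIdeal S := by
    intro x hx
    refine Submodule.mul_induction_on hx (fun a ha j hj => ⟨Ideal.mul_mem_left _ a hj, ?_⟩)
      (fun x y hx hy => ⟨add_mem hx.1 hy.1, ?_⟩)
    · rw [he_smul a j hj]; exact Ideal.mul_mem_right _ _ (map_nonunit ι a ha)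
    · rw [he_add x hx.1 y hy.1]; exact add_mem hx.2 hy.2
  have he_J2 : ∀ x ∈ J, x ∈ maximalIdeal R ^ 2 → e x ∈ maximalIdeal S :=
    fun x hx hx2 => (he_mJ x (hJ2 ⟨hx, hx2⟩)).2
  -- `c g := e (τ g t)`: `τ₁ g u = c g * u`, a unit; the character `χ g := c g mod 𝔫`
  have hres' : ∀ (g : I) (s : S), residue S (τ₁ g s) = residue S s := fun g s => by
    rw [← sub_eq_zero, ← map_sub, residue_eq_zero_iff]; exact hres g s
  have hτt : ∀ g : I, τ g t ∈ J := fun g => hJτ g t ht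
  obtain ⟨c, hc⟩ : ∃ c : I → S, ∀ g, c g = e (τ g t) := ⟨_, fun _ => rfl⟩
  have hcu : ∀ g, c g * u = τ₁ g u := fun g => by rw [hc, he _ (hτt g), hcomp]
  have he_τ : ∀ (g : I), ∀ r ∈ J, e (τ g r) = τ₁ g (e r) * c g := fun g r hr =>
    he_uniq _ (hJτ g r hr) _ (by rw [mul_assoc, hcu, ← map_mul, he r hr, hcomp])
  have hc_mul : ∀ g h : I, c (g * h) = τ₁ g (c h) * c g := fun g h => by
    rw [hc (g * h), map_mul, RingAut.mul_apply, he_τ g _ (hτt h), ← hc h]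
  have hc_one : c 1 = 1 := by rw [hc, map_one, RingAut.one_apply, he_t]
  have hc_res : ∀ g, residue S (c g) ≠ 0 := fun g => (residue_ne_zero_iff_isUnit _).mpr
    (IsUnit.of_mul_eq_one_right (τ₁ g (c g⁻¹)) (by rw [← hc_mul, mul_inv_cancel, hc_one]))
  obtain ⟨χ, hχ⟩ : ∃ χ : I →* (ResidueField S)ˣ, ∀ g, (χ g : ResidueField S) = residue S (c g) :=
    ⟨{ toFun := fun g => Units.mk0 (residue S (c g)) (hc_res g)
       map_one' := Units.ext (by simp only [Units.val_mk0, hc_one, map_one, Units.val_one])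
       map_mul' := fun g h => Units.ext (by
         simp only [Units.val_mk0, Units.val_mul, hc_mul, map_mul, hres']
         rw [mul_comm]) }, fun g => rfl⟩
  -- (3) `W̃ := {r ∈ J | e r ∈ 𝔫}` (the set `L`) is `τ`-stable and `(τ g - 1) J ⊆ W̃` on `ker χ`
  obtain ⟨L, hL⟩ : ∃ L : Set R, ∀ r, r ∈ L ↔ r ∈ J ∧ e r ∈ maximalIdeal S := ⟨_, fun _ => Iff.rfl⟩
  have hW_τ : ∀ (g : I), ∀ r ∈ L, τ g r ∈ L := fun g r hr => by
    obtain ⟨hrJ, her⟩ := (hL r).mp hr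
    exact (hL _).mpr ⟨hJτ g r hrJ, he_τ g r hrJ ▸
      Ideal.mul_mem_right _ _ (ringAut_apply_mem_maximalIdeal (τ₁ g) her)⟩
  have hW_χ : ∀ g : I, χ g = 1 → ∀ r ∈ J, τ g r - r ∈ L := by
    intro g hg r hr
    refine (hL _).mpr ⟨sub_mem (hJτ g r hr) hr, ?_⟩
    rw [← residue_eq_zero_iff, he_sub _ (hJτ g r hr) _ hr, he_τ g r hr, map_sub, map_mul, hres',
      show residue S (c g) = 1 by rw [← hχ, hg, Units.val_one], mul_one, sub_self]
  -- the image `W` of `W̃` in `V` is a proper subspace (`t̄ ∉ W`) of `J̄ = κ j̄₁ + κ j̄₂`: a line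
  obtain ⟨w₀, hw₀, hgenW⟩ : ∃ w₀ : R, w₀ ∈ L ∧
      ∀ r ∈ L, ∃ a : R, r - a * w₀ ∈ maximalIdeal R ^ 2 := by
    obtain ⟨j₁, hj₁, j₂, hj₂, hJg⟩ := hJgen
    set x₁ := (maximalIdeal R).toCotangent ⟨j₁, hJm hj₁⟩
    set x₂ := (maximalIdeal R).toCotangent ⟨j₂, hJm hj₂⟩
    let P : Submodule (ResidueField R) (CotangentSpace R) :=
      Submodule.span (ResidueField R) {x₁, x₂}
    have hPJ : ∀ r : ↥(maximalIdeal R), (r : R) ∈ J → (maximalIdeal R).toCotangent r ∈ P := by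
      intro r hr
      obtain ⟨a, b, hab⟩ := hJg r hr
      have h : (maximalIdeal R).toCotangent r =
          (maximalIdeal R).toCotangent (a • ⟨j₁, hJm hj₁⟩ + b • ⟨j₂, hJm hj₂⟩) := by
        rw [Ideal.toCotangent_eq]; simpa using hab
      rw [h, map_add, map_smul, map_smul]
      exact add_mem (P.smul_of_tower_mem a (Submodule.subset_span (Set.mem_insert _ _)))
        (P.smul_of_tower_mem b (Submodule.subset_span (Set.mem_insert_of_mem _ rfl)))
    let W : Submodule (ResidueField R) (CotangentSpace R) :=
      { carrier := {v | ∃ r : ↥(maximalIdeal R), (r : R) ∈ L ∧ (maximalIdeal R).toCotangent r = v}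
        add_mem' := fun {v v'} hv hv' => by
          obtain ⟨r, hr, rfl⟩ := hv
          obtain ⟨r', hr', rfl⟩ := hv'
          obtain ⟨hrJ, her⟩ := (hL _).mp hr
          obtain ⟨hrJ', her'⟩ := (hL _).mp hr'
          refine ⟨r + r', (hL _).mpr ⟨?_, ?_⟩, map_add _ _ _⟩
          · rw [Submodule.coe_add]; exact add_mem hrJ hrJ'
          · rw [Submodule.coe_add, he_add _ hrJ _ hrJ']; exact add_mem her her'
        zero_mem' := ⟨0, (hL _).mpr ⟨by rw [Submodule.coe_zero]; exact zero_mem _,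
          by rw [Submodule.coe_zero, he_zero]; exact zero_mem _⟩, map_zero _⟩
        smul_mem' := fun k {v} hv => by
          obtain ⟨r, hr, rfl⟩ := hv
          obtain ⟨hrJ, her⟩ := (hL _).mp hr
          obtain ⟨a, rfl⟩ := residue_surjective k
          refine ⟨a • r, (hL _).mpr ⟨?_, ?_⟩, ?_⟩
          · rw [Submodule.coe_smul, smul_eq_mul]; exact Ideal.mul_mem_left _ _ hrJ
          · rw [Submodule.coe_smul, smul_eq_mul, he_smul a _ hrJ]
            exact Ideal.mul_mem_left _ _ her
          · rw [map_smul]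
            rfl }
    have hWP : W ≤ P := fun v ⟨r, hr, hrv⟩ => by rw [← hrv]; exact hPJ r ((hL _).mp hr).1
    have htW : (maximalIdeal R).toCotangent ⟨t, hJm ht⟩ ∉ W := by
      rintro ⟨r, hr, hrt⟩
      obtain ⟨hrJ, her⟩ := (hL _).mp hr
      rw [Ideal.toCotangent_eq] at hrt
      have h1 := he_J2 _ (sub_mem hrJ ht) hrt
      rw [he_sub _ hrJ _ ht, he_t] at h1
      exact (maximalIdeal.isMaximal S).ne_top
        ((Ideal.eq_top_iff_one _).mpr (by simpa using sub_mem her h1))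
    have h1 := Submodule.finrank_lt_finrank_of_lt
      (SetLike.lt_iff_le_and_exists.mpr ⟨hWP, _, hPJ ⟨t, hJm ht⟩ ht, htW⟩)
    have h2 := finrank_span_finset_le_card (R := ResidueField R) ({x₁, x₂} : Finset _)
    rw [Finset.coe_pair] at h2
    haveI : W.IsPrincipal := (Submodule.finrank_le_one_iff_isPrincipal W).mp
      (by have := h1.trans_le (h2.trans Finset.card_le_two); omega)
    obtain ⟨v, hv⟩ := Submodule.IsPrincipal.principal W
    obtain ⟨w₀, hw₀, hw₀v⟩ : v ∈ W := by rw [hv]; exact Submodule.mem_span_singleton_self v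
    refine ⟨w₀, hw₀, fun r hr => ?_⟩
    have hrm : r ∈ maximalIdeal R := hJm ((hL r).mp hr).1
    have hrW : (maximalIdeal R).toCotangent ⟨r, hrm⟩ ∈ W := ⟨⟨r, hrm⟩, hr, rfl⟩
    rw [hv, Submodule.mem_span_singleton] at hrW
    obtain ⟨k, hk⟩ := hrW
    obtain ⟨a, rfl⟩ := residue_surjective k
    rw [← hw₀v] at hk
    have h : (maximalIdeal R).toCotangent ⟨r, hrm⟩ = (maximalIdeal R).toCotangent (a • w₀) := by
      rw [← hk, map_smul]; rfl
    exact ⟨a, by simpa using (Ideal.toCotangent_eq _).mp h⟩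
  -- the character `μ` of `I` on the line `W`
  obtain ⟨μ, hμ⟩ : ∃ μ : I →* (ResidueField R)ˣ, ∀ g, μ g = 1 →
      ∀ r ∈ L, τ g r - r ∈ maximalIdeal R ^ 2 :=
    exists_character_of_line τ hresR (fun r hr => hJm ((hL r).mp hr).1) hW_τ
      (maximalIdeal R ^ 2) hm2τ le_rfl hw₀ hgenW
  -- (5)/(6) `U := ker (χ, μ, ν)`: for `g ∈ U`, `r ∈ 𝔪`, `(τ g - 1)³ r ∈ 𝔪²`, so `g ^ (p ^ 2) ∈ K`
  refine hasNormalSylow_of_character p hτ hresR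
    (prod_eq_one_of_pow_eq_one (prod_eq_one_of_pow_eq_one
      (fun a h => units_eq_one_of_pow_char_eq_one p h)
      (fun a h => units_eq_one_of_pow_char_eq_one p h))
      (fun a h => units_eq_one_of_pow_char_eq_one p h))
    ((χ.prod μ).prod ν) 2 fun g hg r hr => ?_
  rw [MonoidHom.prod_apply, MonoidHom.prod_apply, Prod.mk_eq_one, Prod.mk_eq_one] at hg
  obtain ⟨⟨hgχ, hgμ⟩, hgν⟩ := hg
  obtain ⟨j, hj, m, hm, hjm⟩ := Submodule.mem_sup.mp (hν g hgν r hr)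
  have h3 : τ g (τ g (τ g r - r) - (τ g r - r)) - (τ g (τ g r - r) - (τ g r - r)) ∈
      maximalIdeal R ^ 2 := by
    have key : τ g (τ g (τ g r - r) - (τ g r - r)) - (τ g (τ g r - r) - (τ g r - r)) =
        (τ g (τ g j - j) - (τ g j - j)) + (τ g (τ g m - m) - (τ g m - m)) := by
      rw [← hjm]; simp only [map_add, map_sub]; ring
    rw [key]
    have hm' : τ g m - m ∈ maximalIdeal R ^ 2 := sub_mem (hm2τ g m hm) hm
    exact add_mem (hμ g hgμ _ (hW_χ g hgχ j hj)) (sub_mem (hm2τ g _ hm') hm')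
  have h4 := pow_apply_sub_mem_of_flag (τ g) h3 (p ^ 2)
  have h5 : (p ^ 2) • (τ g r - r) ∈ maximalIdeal R ^ 2 := by
    rw [nsmul_eq_mul, Nat.cast_pow, pow_two (p : R), mul_assoc]
    exact hmm _ hp_mem _ (Ideal.mul_mem_left _ _ (hresR g r))
  have h6 : ((p ^ 2).choose 2) • (τ g (τ g r - r) - (τ g r - r)) ∈ maximalIdeal R ^ 2 := by
    obtain ⟨k, hk⟩ := hp.dvd_choose_pow (n := 2) two_ne_zero
      (by have h22 : 2 ^ 2 ≤ p ^ 2 := Nat.pow_le_pow_left hp.two_le 2; omega)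
    rw [hk, nsmul_eq_mul, Nat.cast_mul, mul_assoc]
    exact hmm _ hp_mem _ (Ideal.mul_mem_left _ _ (hresR g _))
  have h7 := add_mem (add_mem h4 h6) h5
  rwa [sub_add_cancel, sub_add_cancel, ← map_pow] at h7

end Summit.ResolutionOfSingularities.ResolutionOfSingularities.Theorems.WildQuotientResolution.FlagCore
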